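import Literature.NumberTheory.EllipticCurves.NeronLocalHeightPotentialGoodReduction
import Literature.NumberTheory.EllipticCurves.NeronLocalHeightTateNormalForm
import Literature.NumberTheory.EllipticCurves.TateNormalFormComponents
import Literature.NumberTheory.EllipticCurves.VariableChangePoints
import Literature.RingTheory.DiscreteValuationRing.AdicCompletionHensel
import Mathlib.AlgebraicGeometry.EllipticCurve.IsomOfJ
import Mathlib.FieldTheory.IsAlgClosed.AlgebraicClosure
import HarnessLib

/-!
# The Néron local height at the places of potentially multiplicative reduction: the `B₂`-structure

Topic `NumberTheory/EllipticCurves` (family `abc`, G06). Pure proofs, no definitions, no named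
facts. This is the case `|j_E|_v > 1` of the local height theory behind Petsche's Lemma 3
(`Literature.NumberTheory.EllipticCurves.Petsche2006_lemma3`, C. Petsche, New York J. Math. 12
(2006), §2, "Case 2: `|j_E|_v > 1`. By Tate's uniformization theory we have maps
`E(k_v) → k_v^×/q^ℤ → ℝ/ℤ` … `j_v(P, Q) = ½ B₂(r(P − Q)) log|j_E|_v`", with `i_v ≥ 0` and
`i_v = 0` off `E₀`), in the form consumed by `Petsche2006_lemma3_of_localStructure`
(`LangHeightLemma3Counting.lean`):

* `exists_addMonoidHom_bernoulli_of_one_lt_padicAbv_j` — for an elliptic curve over `ℚ` (any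
  Weierstrass equation `W`) and a finite place `v` with `|j(W)|_v > 1` there is a homomorphism
  `r : E(ℚ) → ℝ/ℤ` with `λ_v(P) ≥ ½ 𝐁₂(r(P)) log|j|_v` for all rational `P ≠ O`, and equality
  whenever `r(P) ≠ 0` (`λ_v = neronLocalHeight (padicAbv v)`, Tate's series, ATAEC Thm. VI.1.1).

It covers the split multiplicative, non-split multiplicative and additive potentially
multiplicative places alike, and in particular yields the inequality of the named fact
`exists_bernoulli_le_neronLocalHeight_of_hasSplitMultiplicativeReductionAt`
(`NeronLocalHeightBadPlaces.lean`) since `log|j|_v = ord_v(Δ_min) log p_v` at a multiplicative place.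

## Proof

No `p`-adic uniformisation is used. Instead:

* (`j_jModel`, `Δ_jModel`, `c₄_jModel`) the integral `j`-model
  `I_a : y² + xy = x³ + 36ax + a` with `a = −1/(j − 1728)` has `j(I_a) = 1728 − a⁻¹ = j`
  (Silverman AEC, proof of Prop. III.1.4(c), rescaled), `c₄ = 1 − 1728a`, `Δ = −a(1 − 1728a)²`;
* (`exists_addMonoidHom_zmod_jModel`, the local theorem) over a Henselian discrete valuation ring
  `R` with `a ∈ 𝔪 ∖ {0}` the model `I_a` reduces to the *split* node `y² + xy = x³`, so the tree's
  Tate normal form `y² + xy = x³ + απⁿ` (`WeierstrassCurve.exists_variableChange_eq_tateNormalForm`),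
  its component homomorphism `c : E(K) → ℤ/nℤ` (`LocalIndex.exists_addMonoidHom_zmod_of_tateNormalForm`)
  and the evaluation of Tate's series on it (`LocalIndex.neronLocalHeight_eq_of_tateNormalForm`,
  ATAEC Thm. VI.4.2(b) for Tate's `λ`) give `λ(Q) ≥ ½ 𝐁₂(c(Q)/n) log|a|⁻¹` with equality off the
  kernel, where `n v(π) = v(a)` because `|Δ_J| = |a₆(J)| = |Δ_{I_a}| = |a|`;
* (`exists_addMonoidHom_bernoulli_of_one_lt_padicAbv_j`) over `ℚ̄` the curve `W` is isomorphic
  to `I_a` (Mathlib `exists_variableChange_of_j_eq`); the isomorphism descends to the number field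
  `L = ℚ(u, r, s, t)` of its coefficients; at a place `w ∣ p_v` of `L`, in the completion `L_w`,
  `|a|_w < 1` and the local theorem applies to `I_a ⊗ O_w`; Tate's series is transported along
  `E(ℚ) → E(L) → I_a(L) → I_a(L_w)` (ATAEC VI.1.1(b),(c): `neronLocalHeight_pointMap`,
  `neronLocalHeight_baseChange`) and rescaled from the restriction of `‖·‖_w` to `|·|_v` by
  Ostrowski (`exists_rpow_eq_padicAbv`, `neronLocalHeight_eq_mul_of_rpow_eq`), under which
  `log|a|_w⁻¹ ↦ log|j|_v` (`|a|_v = |j − 1728|_v⁻¹ = |j|_v⁻¹`).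

## References

* C. Petsche, *Small rational points on elliptic curves over number fields*, New York J. Math. 12
  (2006), 257–268 (arXiv math/0508160), §2 and Lemma 3.
* J. H. Silverman, *Advanced Topics in the Arithmetic of Elliptic Curves*, GTM 151 (1994),
  Thm. VI.1.1, Thm. VI.4.2 (PDF pp. 419–430 of the held copy), V.3–V.5 (the Tate curve).
* J. H. Silverman, *The Arithmetic of Elliptic Curves*, 2nd ed. (2009), Prop. III.1.4(c),
  Prop. VII.5.1(b), Prop. VII.5.5.
-/

noncomputable section

open scoped Classical NumberField

namespace WeierstrassCurve

/-! ### Equal Weierstrass equations: the identity on points -/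

/-- Two *equal* Weierstrass equations over a field have canonically isomorphic groups of points,
by an isomorphism which is the identity on coordinates, preserves being `O`, and preserves Tate's
local height for every absolute value (all by substitution). [folklore] -/
theorem exists_addEquiv_of_eq {F : Type*} [Field F] {V V' : WeierstrassCurve F} (h : V = V')
    (v : AbsoluteValue F ℝ) :
    ∃ e : V.toAffine.Point ≃+ V'.toAffine.Point,
      (∀ {x y : F} (hxy : V.toAffine.Nonsingular x y), ∃ h', e (.some x y hxy) = .some x y h') ∧
      ∀ P, Affine.Point.neronLocalHeight v (e P) = Affine.Point.neronLocalHeight v P := by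
  subst h
  exact ⟨AddEquiv.refl _, fun hxy => ⟨hxy, rfl⟩, fun _ => rfl⟩


end WeierstrassCurve

namespace Literature.NumberTheory.EllipticCurves

open IsLocalRing _root_.WeierstrassCurve _root_.WeierstrassCurve.Affine.Point

/-! ### The local theorem: `y² + xy = x³ + 36ax + a`, `a ∈ 𝔪 ∖ {0}`, over a Henselian DVR -/

section Local

variable {R : Type*} [CommRing R] [IsDomain R] [IsDiscreteValuationRing R] [HenselianLocalRing R]
  {K : Type*} [Field K] [Algebra R K] [IsFractionRing R K] {abv : AbsoluteValue K ℝ}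
  (hna : IsNonarchimedean abv) (habv : ∀ x : K, abv x ≤ 1 ↔ ValuationRing.valuation R K x ≤ 1)
  (h2 : (2 : K) ≠ 0)

omit [IsDomain R] [IsDiscreteValuationRing R] [HenselianLocalRing R] in
/-- `Δ = −a(1 − 1728a)²` for `y² + xy = x³ + 36ax + a`. [folklore] -/
theorem Δ_jModel (a : R) : (⟨1, 0, 0, 36 * a, a⟩ : WeierstrassCurve R).Δ = -(a * (1 - 1728 * a) ^ 2) := by
  simp only [WeierstrassCurve.Δ, WeierstrassCurve.b₂, WeierstrassCurve.b₄, WeierstrassCurve.b₆,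
    WeierstrassCurve.b₈]
  ring

omit [IsDomain R] [IsDiscreteValuationRing R] [HenselianLocalRing R] in
/-- `c₄ = 1 − 1728a` for `y² + xy = x³ + 36ax + a`. [folklore] -/
theorem c₄_jModel (a : R) : (⟨1, 0, 0, 36 * a, a⟩ : WeierstrassCurve R).c₄ = 1 - 1728 * a := by
  simp only [WeierstrassCurve.c₄, WeierstrassCurve.b₂, WeierstrassCurve.b₄]
  ring

include hna habv h2 in
/-- **The `B₂`-structure of Tate's `λ` on `y² + xy = x³ + 36ax + a`, `a ∈ 𝔪 ∖ {0}`** (the integral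
model of the curve of `j`-invariant `j = 1728 − a⁻¹`, `|j| = |a|⁻¹ > 1`, Silverman AEC
Prop. III.1.4(c); it has split multiplicative reduction: `c₄ = 1 − 1728a ∈ Rˣ`,
`Δ = −a(1 − 1728a)² ∈ 𝔪`, node `(0, 0)` of `y² + xy = x³` with tangents `y = 0`, `y = −x`).
Over a Henselian discrete valuation ring `R` with fraction field `K` and a nonarchimedean absolute
value `|·|` with unit ball `R` (and `2 ≠ 0` in `K`): there are `n ≥ 1` and a homomorphism
`ρ : E(K) → ℤ/nℤ` such that for every `Q ∈ E(K) ∖ {O}`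
`λ(Q) ≥ ½ 𝐁₂(ρ(Q)/n) · log|a|⁻¹`, with equality whenever `ρ(Q) ≠ 0` — Silverman ATAEC
Thm. VI.4.2(b) for Tate's series, obtained from the Tate normal form `y² + xy = x³ + απⁿ` of the
equation (`WeierstrassCurve.exists_variableChange_eq_tateNormalForm`), the component homomorphism
`LocalIndex.exists_addMonoidHom_zmod_of_tateNormalForm` and
`LocalIndex.neronLocalHeight_eq_of_tateNormalForm`; here `n v(π) = v(a) = log|j|`.
[cite: Silverman1994, Thm VI.4.2(b)] -/
theorem exists_addMonoidHom_zmod_jModel {a : R} (ha : a ∈ maximalIdeal R) (ha0 : a ≠ 0) :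
    ∃ (n : ℕ) (_ : NeZero n)
      (ρ : ((⟨1, 0, 0, 36 * a, a⟩ : WeierstrassCurve R).baseChange K).toAffine.Point →+ ZMod n),
      (∀ Q, Q ≠ 0 → 1 / 2 * periodizedBernoulli 2 (ZMod.toAddCircle (ρ Q)) *
          (-Real.log (abv (algebraMap R K a))) ≤ neronLocalHeight abv Q) ∧
      (∀ Q, ρ Q ≠ 0 → neronLocalHeight abv Q = 1 / 2 * periodizedBernoulli 2 (ZMod.toAddCircle (ρ Q)) *
          (-Real.log (abv (algebraMap R K a)))) := by
  set I : WeierstrassCurve R := ⟨1, 0, 0, 36 * a, a⟩ with hI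
  set f := algebraMap R K with hf
  have hinj : Function.Injective f := IsFractionRing.injective R K
  -- the reduction of `I` is the split node `y² + xy = x³`
  have hunit : IsUnit (1 - 1728 * a) := by
    by_contra hu
    have hmem : 1 - 1728 * a ∈ maximalIdeal R := (mem_maximalIdeal _).mpr hu
    have : (1 : R) ∈ maximalIdeal R := by
      have h := Ideal.add_mem _ hmem (Ideal.mul_mem_left _ (1728 : R) ha)
      rwa [sub_add_cancel] at h
    exact (maximalIdeal.isMaximal R).ne_top ((Ideal.eq_top_iff_one _).mpr this)
  have hΔ : I.Δ ∈ maximalIdeal R := by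
    rw [hI, Δ_jModel, Ideal.neg_mem_iff]
    exact Ideal.mul_mem_right _ _ ha
  have hΔ0 : I.Δ ≠ 0 := by
    rw [hI, Δ_jModel, neg_ne_zero]
    exact mul_ne_zero ha0 (pow_ne_zero 2 hunit.ne_zero)
  have hc₄ : I.c₄ ∉ maximalIdeal R := by
    rw [hI, c₄_jModel]
    exact fun h => (mem_maximalIdeal _).mp h hunit
  have hsplit : ∃ μ : ResidueField R, letI Ib := I.map (residue R);
      Ib.c₄ * μ ^ 2 + Ib.a₁ * Ib.c₄ * μ - (54 * Ib.b₆ - 3 * Ib.b₂ * Ib.b₄ + Ib.a₂ * Ib.c₄) = 0 := by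
    refine ⟨0, ?_⟩
    simp only [hI, WeierstrassCurve.map, WeierstrassCurve.b₂, WeierstrassCurve.b₄,
      WeierstrassCurve.b₆, WeierstrassCurve.c₄, _root_.map_zero, _root_.map_one, _root_.map_mul,
      map_ofNat]
    ring
  -- Tate normal form `J = D • I : y² + xy = x³ + απⁿ`
  obtain ⟨D, hD1, hD2, hD3, hD4, hD6⟩ := I.exists_variableChange_eq_tateNormalForm hΔ hc₄ hsplit
  set J : WeierstrassCurve R := D • I with hJ
  have hJΔ : J.Δ = ↑D.u⁻¹ ^ 12 * I.Δ := by rw [hJ, variableChange_Δ]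
  have hJΔ0 : J.Δ ≠ 0 := by
    rw [hJΔ]; exact mul_ne_zero (pow_ne_zero _ (Units.ne_zero _)) hΔ0
  have ha60 : J.a₆ ≠ 0 := by
    intro h0
    apply hJΔ0
    rw [J.Δ_eq_of_tateNormalForm hD1 hD2 hD3 hD4, h0]
    ring
  obtain ⟨ϖ, hϖ⟩ := IsDiscreteValuationRing.exists_irreducible R
  obtain ⟨n, α, hα6⟩ := IsDiscreteValuationRing.eq_unit_mul_pow_irreducible ha60 hϖ
  have h6 : J.a₆ = (α : R) * ϖ ^ n := hα6
  have hn : 1 ≤ n := by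
    by_contra hlt
    push Not at hlt
    have hn0 : n = 0 := by omega
    rw [hn0, pow_zero, mul_one] at h6
    exact (mem_maximalIdeal _).mp (h6 ▸ hD6) α.isUnit
  haveI : NeZero n := ⟨by omega⟩
  obtain ⟨c, hc0, hcl, hcl', hcm⟩ :=
    LocalIndex.exists_addMonoidHom_zmod_of_tateNormalForm (K := K) J hϖ hD1 hD2 hD3 hD4 α.isUnit hn h6
  -- the points of `I ⊗ K` and of `J ⊗ K = D_K • (I ⊗ K)`
  have hcurve : (D.map f) • (I.baseChange K) = J.baseChange K := by
    rw [hJ, WeierstrassCurve.baseChange, WeierstrassCurve.baseChange, map_variableChange]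
  obtain ⟨e, he, helam⟩ := exists_addEquiv_of_eq hcurve abv
  haveI : (I.baseChange K).IsElliptic := by
    refine ⟨isUnit_iff_ne_zero.mpr ?_⟩
    rw [WeierstrassCurve.baseChange, map_Δ]
    exact (map_ne_zero_iff f hinj).mpr hΔ0
  let Φ : (I.baseChange K).toAffine.Point →+ (J.baseChange K).toAffine.Point :=
    e.toAddMonoidHom.comp (VariableChange.pointEquiv (I.baseChange K) (D.map f)).toAddMonoidHom
  have hΦ : ∀ Q, Φ Q = e (VariableChange.pointMap (I.baseChange K) (D.map f) Q) := fun Q => rfl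
  have hΦlam : ∀ Q, Q ≠ 0 → neronLocalHeight abv (Φ Q) = neronLocalHeight abv Q := fun Q hQ => by
    rw [hΦ, helam, neronLocalHeight_pointMap abv (D.map f) h2 hQ]
  -- `n v(π) = v(a)`: `|a₆| = |π|ⁿ`, `|Δ_J| = |a₆| = |Δ_I| = |a|`
  have habv1 : ∀ {r : R}, IsUnit r → abv (f r) = 1 := fun hr =>
    LocalIndex.abv_algebraMap_eq_one habv hr
  have hunit' : IsUnit (1 + 432 * J.a₆) := by
    by_contra hu
    have hmem : 1 + 432 * J.a₆ ∈ maximalIdeal R := (mem_maximalIdeal _).mpr hu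
    have : (1 : R) ∈ maximalIdeal R := by
      have h := Ideal.sub_mem _ hmem (Ideal.mul_mem_left _ (432 : R) hD6)
      rwa [add_sub_cancel_right] at h
    exact (maximalIdeal.isMaximal R).ne_top ((Ideal.eq_top_iff_one _).mpr this)
  have hkey : abv (f ϖ) ^ n = abv (f a) := by
    have h1 : abv (f J.a₆) = abv (f ϖ) ^ n := by
      rw [h6, _root_.map_mul, _root_.map_pow, _root_.map_mul, _root_.map_pow, habv1 α.isUnit,
        one_mul]
    have h2' : abv (f J.Δ) = abv (f J.a₆) := by
      rw [J.Δ_eq_of_tateNormalForm hD1 hD2 hD3 hD4, _root_.map_neg, abv.map_neg, _root_.map_mul,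
        _root_.map_mul, habv1 hunit', mul_one]
    have h3 : abv (f J.Δ) = abv (f I.Δ) := by
      rw [hJΔ, _root_.map_mul, _root_.map_pow, _root_.map_mul, _root_.map_pow,
        habv1 (Units.isUnit _), one_pow, one_mul]
    have h4 : abv (f I.Δ) = abv (f a) := by
      rw [hI, Δ_jModel, _root_.map_neg, abv.map_neg, _root_.map_mul, _root_.map_pow,
        _root_.map_mul, _root_.map_pow, habv1 hunit, one_pow, mul_one]
    rw [← h1, ← h2', h3, h4]
  have hlog : (n : ℝ) * (-Real.log (abv (f ϖ))) = -Real.log (abv (f a)) := by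
    rw [← hkey, Real.log_pow]
    ring
  refine ⟨n, inferInstance, c.comp Φ, fun Q hQ => ?_, fun Q hρ => ?_⟩
  · -- the lower bound (`le_neronLocalHeight_of_tateNormalForm`)
    have hT := LocalIndex.le_neronLocalHeight_of_tateNormalForm J habv hϖ hD1 hD2 hD3 hD4 α.isUnit
      hn h6 hna hc0 hcl hcl' hcm (Φ Q)
    rw [hΦlam Q hQ, hlog] at hT
    exact hT
  · -- the exact value off the kernel (`neronLocalHeight_eq_of_tateNormalForm`, `λ₁ = 0` there)
    have hρ' : c (Φ Q) ≠ 0 := hρ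
    have hQ : Q ≠ 0 := by
      rintro rfl
      exact hρ' (by rw [_root_.map_zero, _root_.map_zero])
    have hns : ¬ J.HasNonsingularReduction (Φ Q) := fun h => hρ' ((hc0 _).mpr h)
    have hnaive : naiveLocalHeight abv (Φ Q) = 0 := by
      rcases hP : Φ Q with _ | ⟨x, y, hxy⟩
      · rfl
      · rw [hP] at hns
        have hx : x ∈ Set.range f := by
          by_contra hx
          exact hns (Or.inl hx)
        obtain ⟨x₀, rfl⟩ := hx
        rw [naiveLocalHeight_some, (Real.posLog_eq_zero_iff _).mpr, mul_zero]
        rw [abs_of_nonneg (abv.nonneg _)]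
        exact LocalIndex.abv_algebraMap_le_one habv x₀
    have hT := LocalIndex.neronLocalHeight_eq_of_tateNormalForm J habv hϖ hD1 hD2 hD3 hD4 α.isUnit
      hn h6 hna hc0 hcl hcl' hcm (Φ Q)
    rw [hΦlam Q hQ, hnaive, zero_add, hlog] at hT
    exact hT

end Local

/-! ### The theorem over `ℚ`: the places with `|j|_v > 1` -/

open IsDedekindDomain Rat.HeightOneSpectrum

/-- A private copy of the going-up lemma of `NeronLocalHeightPotentialGoodReduction.lean`: over
every rational prime there is a finite place of the number field `L`. [folklore] -/
private theorem exists_place_natCast_mem' {L : Type*} [Field L] [NumberField L] {p : ℕ}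
    (hp : p.Prime) : ∃ w : HeightOneSpectrum (𝓞 L), (p : 𝓞 L) ∈ w.asIdeal := by
  have hpZ : Prime (p : ℤ) := Nat.prime_iff_prime_int.mp hp
  haveI hpI : (Ideal.span {(p : ℤ)}).IsMaximal :=
    ((Ideal.span_singleton_prime hpZ.ne_zero).mpr hpZ).isMaximal (by simpa using hpZ.ne_zero)
  obtain ⟨Q, hQmax, hQover⟩ :=
    Ideal.exists_maximal_ideal_liesOver_of_isIntegral (S := 𝓞 L) (Ideal.span {(p : ℤ)})
  have hQne : Q ≠ ⊥ := by
    rintro rfl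
    have h1 : Ideal.span {(p : ℤ)} = Ideal.comap (algebraMap ℤ (𝓞 L)) ⊥ := hQover.over
    rw [Ideal.comap_bot_of_injective (algebraMap ℤ (𝓞 L)) (RingHom.injective_int _)] at h1
    exact hpZ.ne_zero (Ideal.span_singleton_eq_bot.mp h1)
  refine ⟨⟨Q, hQmax.isPrime, hQne⟩, ?_⟩
  have h1 : (p : ℤ) ∈ Q.under ℤ := hQover.over ▸ Ideal.mem_span_singleton_self _
  simpa using h1

/-- The `j`-invariant of `y² + xy = x³ + 36ax + a` over a field is `1728 − a⁻¹`
(for `a ≠ 0`, `1 − 1728a ≠ 0`). [cite: SilvermanAEC2009, Prop. III.1.4(c)] -/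
theorem j_jModel {F : Type*} [Field F] {a : F} (ha0 : a ≠ 0) (ha1 : 1 - 1728 * a ≠ 0) :
    haveI : (⟨1, 0, 0, 36 * a, a⟩ : WeierstrassCurve F).IsElliptic :=
      ⟨by rw [Δ_jModel]; exact (ha0.isUnit.mul (ha1.isUnit.pow 2)).neg⟩
    (⟨1, 0, 0, 36 * a, a⟩ : WeierstrassCurve F).j = 1728 - a⁻¹ := by
  rw [WeierstrassCurve.j, Units.inv_mul_eq_iff_eq_mul, WeierstrassCurve.coe_Δ', c₄_jModel,
    Δ_jModel]
  field_simp
  ring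

/-- `|j − 1728|_v = |j|_v` when `|j|_v > 1` (ultrametric inequality, `|1728|_v ≤ 1`). [folklore] -/
theorem padicAbv_sub_ofNat_eq (v : HeightOneSpectrum ℤ) {x : ℚ} (hx : 1 < padicAbv v x) :
    padicAbv v (x - 1728) = padicAbv v x := by
  haveI : Fact (natGenerator v).Prime := ⟨prime_natGenerator v⟩
  have hna : IsNonarchimedean (padicAbv v) := fun a b => by
    simp only [padicAbv_apply]
    exact_mod_cast padicNorm.nonarchimedean
  have h1728 : padicAbv v (1728 : ℚ) ≤ 1 := by
    have := padicAbv_intCast_le_one v 1728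
    exact_mod_cast this
  have hlt : padicAbv v (-(1728 : ℚ)) < padicAbv v x := by
    rw [AbsoluteValue.map_neg]; exact h1728.trans_lt hx
  rw [sub_eq_add_neg]
  exact IsNonarchimedean.add_eq_left_of_lt hna hlt

/-- **The `B₂`-structure of `λ_v` at a place with `|j(E)|_v > 1`** (Petsche 2006, §2, Case 2:
`λ_v(P − Q) = i_v(P, Q) + j_v(P, Q)` with `j_v = ½ B₂(r(P − Q)) log|j_E|_v`, `i_v ≥ 0`, for the
homomorphism `r : E(k_v) → ℝ/ℤ` coming from Tate's uniformisation; Silverman ATAEC Thm. VI.4.2(b)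
with V.5.3). For an elliptic curve over `ℚ` given by any Weierstrass equation `W` and a finite place
`v` with `|j(W)|_v > 1` there is a homomorphism `r : E(ℚ) → ℝ/ℤ` such that
`λ_v(P) ≥ ½ 𝐁₂(r(P)) log|j|_v` for every rational `P ≠ O`, with equality whenever `r(P) ≠ 0`
(`λ_v = neronLocalHeight (padicAbv v)`, Tate's series; `𝐁₂ = periodizedBernoulli 2`). Proof: over
`ℚ̄` the curve is isomorphic to the integral `j`-model `y² + xy = x³ + 36ax + a`,
`a = −1/(j − 1728)` (Mathlib `exists_variableChange_of_j_eq`); the isomorphism is defined over the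
number field `L` generated by its coefficients; at a place `w ∣ p_v` of `L` the `j`-model over
`O_w` is split multiplicative and `exists_addMonoidHom_zmod_jModel` applies in `L_w`; Tate's series
is transported along `E(ℚ) → E(L) → (j-model)(L) → (j-model)(L_w)` (ATAEC VI.1.1(b),(c)) and
rescaled from the restriction of `‖·‖_w` to `|·|_v` by Ostrowski (`exists_rpow_eq_padicAbv`,
`neronLocalHeight_eq_mul_of_rpow_eq`), with `log|a|_w⁻¹ ↦ log|j|_v`.
[cite: Petsche2006, §2 (Case 2) and Lemma 3] [cite: Silverman1994, Thm VI.4.2(b)] -/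
theorem exists_addMonoidHom_bernoulli_of_one_lt_padicAbv_j (W : WeierstrassCurve ℚ) [W.IsElliptic]
    (v : HeightOneSpectrum ℤ) (hj : 1 < padicAbv v W.j) :
    ∃ r : W.toAffine.Point →+ UnitAddCircle,
      (∀ P : W.toAffine.Point, P ≠ 0 →
        1 / 2 * periodizedBernoulli 2 (r P) * Real.log (padicAbv v W.j) ≤
          P.neronLocalHeight (padicAbv v)) ∧
      (∀ P : W.toAffine.Point, r P ≠ 0 →
        P.neronLocalHeight (padicAbv v) =
          1 / 2 * periodizedBernoulli 2 (r P) * Real.log (padicAbv v W.j)) := by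
  -- Step 0: `j ≠ 0, 1728`, `a = −1/(j − 1728)`, the `j`-model over `ℚ`
  set j := W.j with hjdef
  have hj0 : j ≠ 0 := fun h => by rw [h, AbsoluteValue.map_zero] at hj; exact not_lt.mpr zero_le_one hj
  have hj1728 : j - 1728 ≠ 0 := fun h => by
    have := padicAbv_sub_ofNat_eq v hj
    rw [h, AbsoluteValue.map_zero] at this
    exact (zero_lt_one.trans hj).ne this
  set a : ℚ := -(j - 1728)⁻¹ with hadef
  have ha0 : a ≠ 0 := by rw [hadef, neg_ne_zero]; exact inv_ne_zero hj1728
  have ha1 : 1 - 1728 * a ≠ 0 := by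
    have : 1 - 1728 * a = j * (j - 1728)⁻¹ := by rw [hadef]; field_simp; ring
    rw [this]; exact mul_ne_zero hj0 (inv_ne_zero hj1728)
  have hja : j = 1728 - a⁻¹ := by rw [hadef]; field_simp; ring
  have hpa : padicAbv v a = (padicAbv v j)⁻¹ := by
    rw [hadef, AbsoluteValue.map_neg, map_inv₀, padicAbv_sub_ofNat_eq v hj]
  set Ia : WeierstrassCurve ℚ := ⟨1, 0, 0, 36 * a, a⟩ with hIa
  haveI hIaE : Ia.IsElliptic := ⟨by rw [hIa, Δ_jModel]; exact (ha0.isUnit.mul (ha1.isUnit.pow 2)).neg⟩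
  have hIaj : Ia.j = j := by rw [hja]; exact j_jModel ha0 ha1
  -- Step 1: over `ℚ̄`, `W ≅ Ia`; descend the isomorphism to the number field of its coefficients
  haveI : (W.baseChange (AlgebraicClosure ℚ)).IsElliptic := inferInstanceAs (W.map _).IsElliptic
  haveI : (Ia.baseChange (AlgebraicClosure ℚ)).IsElliptic := inferInstanceAs (Ia.map _).IsElliptic
  have hjF : (W.baseChange (AlgebraicClosure ℚ)).j = (Ia.baseChange (AlgebraicClosure ℚ)).j := by
    change (W.map (algebraMap ℚ (AlgebraicClosure ℚ))).j = (Ia.map (algebraMap ℚ (AlgebraicClosure ℚ))).j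
    rw [W.map_j, Ia.map_j, hIaj]
  obtain ⟨C, hC⟩ := exists_variableChange_of_j_eq _ _ hjF
  let L : IntermediateField ℚ (AlgebraicClosure ℚ) := IntermediateField.adjoin ℚ {(C.u : AlgebraicClosure ℚ), C.r, C.s, C.t}
  haveI halg : Algebra.IsAlgebraic ℚ (AlgebraicClosure ℚ) := by
    convert AlgebraicClosure.isAlgebraic ℚ <;> rfl
  haveI : FiniteDimensional ℚ L := IntermediateField.finiteDimensional_adjoin fun x _ =>
    (halg.isAlgebraic x).isIntegral
  haveI : NumberField L := NumberField.mk
  -- use the classical decidable equality on `L` throughout (as the tree's point-group lemmas do)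
  letI instDecEqL : DecidableEq L := fun a b => Classical.propDecidable (a = b)
  obtain ⟨C', hC'⟩ := VariableChange.exists_map_eq_of_mem L C
    (IntermediateField.subset_adjoin ℚ _ (by simp)) (IntermediateField.subset_adjoin ℚ _ (by simp))
    (IntermediateField.subset_adjoin ℚ _ (by simp)) (IntermediateField.subset_adjoin ℚ _ (by simp))
  have hCL : C' • W.baseChange L = Ia.baseChange L := by
    refine smul_baseChange_eq_of_map_eq (F := AlgebraicClosure ℚ) W C' (Ia.baseChange L) ?_
    rw [hC', hC]
    exact (Ia.map_baseChange (IsScalarTower.toAlgHom ℚ L (AlgebraicClosure ℚ))).symm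
  -- Step 2: a place `w ∣ p_v` of `L`, the completion `L_w ⊃ O_w`, its norm, and Ostrowski
  set p : ℕ := natGenerator v with hp
  have hprime : p.Prime := prime_natGenerator v
  obtain ⟨w, hpw⟩ := exists_place_natCast_mem' (L := L) hprime
  let Kw := w.adicCompletion (L : Type)
  let Ow := w.adicCompletionIntegers (L : Type)
  let abw : AbsoluteValue Kw ℝ := NormedField.toAbsoluteValue Kw
  have hna : IsNonarchimedean abw := fun x y => IsUltrametricDist.norm_add_le_max x y
  have hle : ∀ x : Kw, abw x ≤ 1 ↔ Valued.v x ≤ 1 := fun x => Valued.toNormedField.norm_le_one_iff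
  have habw : ∀ x : Kw, abw x ≤ 1 ↔ ValuationRing.valuation Ow Kw x ≤ 1 := fun x => by
    rw [hle, WeierstrassCurve.valued_le_one_iff_mem_range_adicCompletionIntegers,
      ← Valuation.mem_integer_iff, ValuationRing.mem_integer_iff, RingHom.mem_range]
  let vL : AbsoluteValue L ℝ := abw.comp (algebraMap L Kw).injective
  let vQ : AbsoluteValue ℚ ℝ := vL.comp (algebraMap ℚ L).injective
  have hvQ_apply : ∀ x : ℚ, vQ x = ‖algebraMap L Kw (algebraMap ℚ L x)‖ := fun x => rfl
  have hvQna : IsNonarchimedean vQ := by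
    intro x y
    rw [hvQ_apply, hvQ_apply, hvQ_apply, map_add, map_add]
    exact hna _ _
  have hvQp : vQ p < 1 := by
    rw [hvQ_apply, map_natCast (algebraMap ℚ L), Valued.toNormedField.norm_lt_one_iff,
      WeierstrassCurve.valued_algebraMap_adicCompletion]
    have e1 : (p : L) = algebraMap (𝓞 L) L (p : 𝓞 L) := by simp
    rw [e1]
    exact (HeightOneSpectrum.valuation_lt_one_iff_mem _ _).mpr hpw
  obtain ⟨c, hc, hcv⟩ := exists_rpow_eq_padicAbv v hvQna hvQp
  -- `log |j|_v = c · (− log ‖a‖_w)`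
  have hvQa : vQ a < 1 := by
    have h1 : vQ a ^ c < 1 ^ c := by
      rw [hcv, Real.one_rpow, hpa, inv_lt_one_iff₀]
      exact Or.inr hj
    exact (Real.rpow_lt_rpow_iff (vQ.nonneg _) zero_le_one hc).mp h1
  have hvQa0 : 0 < vQ a := vQ.pos ha0
  have hlogj : Real.log (padicAbv v j) = c * (-Real.log (vQ a)) := by
    have h1 : Real.log (padicAbv v a) = c * Real.log (vQ a) := by
      rw [← hcv, Real.log_rpow hvQa0]
    rw [hpa, Real.log_inv] at h1
    linarith
  -- Step 3: the `j`-model over `O_w` and the local theorem in `L_w`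
  have haO1 : Valued.v (algebraMap L Kw (algebraMap ℚ L a)) ≤ 1 := (hle _).mp hvQa.le
  let aO : Ow := ⟨algebraMap L Kw (algebraMap ℚ L a),
    (HeightOneSpectrum.mem_adicCompletionIntegers (𝓞 L) L w).mpr haO1⟩
  have haO : (aO : Kw) = algebraMap L Kw (algebraMap ℚ L a) := rfl
  have haOm : aO ∈ IsLocalRing.maximalIdeal Ow := by
    rw [IsLocalRing.mem_maximalIdeal, mem_nonunits_iff]
    intro hu
    have h1 := LocalIndex.abv_algebraMap_eq_one habw hu
    have h2 : abw (algebraMap Ow Kw aO) = vQ a := rfl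
    rw [h2] at h1
    exact hvQa.ne h1
  have haO0 : aO ≠ 0 := by
    intro h0
    have h1 : (aO : Kw) = 0 := by rw [h0]; rfl
    rw [haO, map_eq_zero, map_eq_zero] at h1
    exact ha0 h1
  have h2K : (2 : Kw) ≠ 0 := by
    rw [← map_ofNat (algebraMap L Kw) 2]
    exact (map_ne_zero_iff _ (algebraMap L Kw).injective).mpr two_ne_zero
  obtain ⟨n, _inst, ρ, hρle, hρeq⟩ := exists_addMonoidHom_zmod_jModel (K := Kw) hna habw h2K haOm haO0
  -- Step 4: the points `E(ℚ) → E(L) → Ia(L) → Ia(L_w) = (j-model ⊗ L_w)(L_w)`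
  set IaL : WeierstrassCurve L := Ia.baseChange L with hIaL
  haveI : (W.baseChange L).IsElliptic := inferInstanceAs (W.map _).IsElliptic
  let ιa : W.toAffine.Point →+ (W.baseChange L).toAffine.Point := Affine.Point.baseChange (W' := W) ℚ L
  have hιa : ∀ {x y : ℚ} (h : W.toAffine.Nonsingular x y),
      ∃ h', ιa (.some x y h) = .some (algebraMap ℚ L x) (algebraMap ℚ L y) h' := fun _ => ⟨_, rfl⟩
  obtain ⟨e₁, he₁, he₁lam⟩ := exists_addEquiv_of_eq hCL vL
  let ιb : IaL.toAffine.Point →+ (IaL.baseChange Kw).toAffine.Point :=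
    Affine.Point.baseChange (W' := IaL) L Kw
  have hιb : ∀ {x y : L} (h : IaL.toAffine.Nonsingular x y),
      ∃ h', ιb (.some x y h) = .some (algebraMap L Kw x) (algebraMap L Kw y) h' := fun _ => ⟨_, rfl⟩
  have hIO : IaL.baseChange Kw =
      ((⟨1, 0, 0, 36 * aO, aO⟩ : WeierstrassCurve Ow).baseChange Kw) := by
    have haO' : algebraMap Ow Kw aO = algebraMap L Kw (algebraMap ℚ L a) := rfl
    rw [hIaL, hIa]
    simp only [WeierstrassCurve.baseChange, WeierstrassCurve.map, _root_.map_one, _root_.map_zero,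
      _root_.map_mul, map_ofNat, haO']
  obtain ⟨e₂, he₂, he₂lam⟩ := exists_addEquiv_of_eq hIO abw
  let Φ : W.toAffine.Point →+ ((⟨1, 0, 0, 36 * aO, aO⟩ : WeierstrassCurve Ow).baseChange Kw).toAffine.Point :=
    e₂.toAddMonoidHom.comp (ιb.comp (e₁.toAddMonoidHom.comp
      ((VariableChange.pointEquiv (W.baseChange L) C').toAddMonoidHom.comp ιa)))
  have hΦ : ∀ P, Φ P = e₂ (ιb (e₁ (VariableChange.pointMap (W.baseChange L) C' (ιa P)))) :=
    fun P => rfl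
  have h2L : (2 : L) ≠ 0 := two_ne_zero
  have hΦlam : ∀ P, P ≠ 0 → neronLocalHeight abw (Φ P) = P.neronLocalHeight vQ := fun P hP => by
    have hP' : ιa P ≠ 0 := fun h0 => hP (Affine.Point.map_injective (Algebra.ofId ℚ L)
      (h0.trans (_root_.map_zero ιa).symm))
    rw [hΦ, he₂lam, neronLocalHeight_baseChange (vF := vL) (vK := abw) ιb hιb (fun _ => rfl),
      he₁lam, neronLocalHeight_pointMap vL C' h2L hP',
      neronLocalHeight_baseChange (vF := vQ) (vK := vL) ιa hιa (fun _ => rfl)]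
  -- Step 5: `r = ρ ∘ Φ / n` and the two conclusions
  have hscale : ∀ P : W.toAffine.Point, P.neronLocalHeight (padicAbv v) = c * P.neronLocalHeight vQ :=
    fun P => neronLocalHeight_eq_mul_of_rpow_eq hc hcv P
  have hlogj' : Real.log (padicAbv v j) = c * -Real.log (abw (algebraMap Ow Kw aO)) := hlogj
  have hΦ0 : ∀ P, Φ P = 0 → P = 0 := fun P h0 => by
    rw [hΦ, AddEquiv.map_eq_zero_iff] at h0
    have h1 : e₁ (VariableChange.pointMap (W.baseChange L) C' (ιa P)) = 0 :=
      Affine.Point.map_injective (W' := IaL) (Algebra.ofId L Kw) (h0.trans (_root_.map_zero ιb).symm)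
    rw [AddEquiv.map_eq_zero_iff, ← VariableChange.pointEquiv_apply, AddEquiv.map_eq_zero_iff] at h1
    exact Affine.Point.map_injective (W' := W) (Algebra.ofId ℚ L) (h1.trans (_root_.map_zero ιa).symm)
  -- scalars: `La = −log ‖a‖_w`, `log |j|_v = c · La`
  obtain ⟨La, hLa⟩ : ∃ La : ℝ, -Real.log (abw (algebraMap Ow Kw aO)) = La := ⟨_, rfl⟩
  rw [hLa] at hlogj'
  simp only [hLa] at hρle hρeq
  refine ⟨(ZMod.toAddCircle : ZMod n →+ UnitAddCircle).comp (ρ.comp Φ), fun P hP => ?_, fun P hr => ?_⟩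
  · have h1 := hρle (Φ P) (fun h0 => hP (hΦ0 P h0))
    have e2 := h1.trans_eq (hΦlam P hP)
    have e3 := mul_le_mul_of_nonneg_left e2 hc.le
    rw [hscale P, hlogj', AddMonoidHom.comp_apply, AddMonoidHom.comp_apply]
    refine le_of_eq_of_le ?_ e3
    ring
  · have hP : P ≠ 0 := by
      rintro rfl
      exact hr (_root_.map_zero _)
    have hr' : ρ (Φ P) ≠ 0 := fun h0 => hr (by
      rw [AddMonoidHom.comp_apply, AddMonoidHom.comp_apply, h0]
      exact _root_.map_zero _)
    have h1 := hρeq (Φ P) hr'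
    have e2 := (hΦlam P hP).symm.trans h1
    refine (hscale P).trans ((congrArg (fun t => c * t) e2).trans ?_)
    simp only [hlogj', AddMonoidHom.coe_comp, Function.comp_apply]
    ring

end Literature.NumberTheory.EllipticCurves

end
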